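import Summits.MatrixMultiplication.OmegaCensus.STPPTricoloredToolkit

/-!
# ω-census, STPP × TSF product route: an 8-element tricolored sum-free set in `ℤ/5 × ℤ/5`

HONEST FRAMING (pub-omega census; verbatim): lottery ticket; floor = certified bounds/negative ranges.
Census STRUCTURE tool of the STPP track (seat pub-omega-stpp-3, gen 28; STRUCTURE row B5, column `T2`), not progress on `ω`.

`exists_isTSF_eight_zmod5_sq`: `ℤ/5 × ℤ/5` carries a tricolored sum-free set of size `8` (found by a depth-first search over triples `(sᵢ, tᵢ, −sᵢ−tᵢ)`,
seat stpp-3 gen 28; maximality not claimed; the cyclic `ℤ/5` carries only `2`, `ℤ/25` carries `7` in the tree's table).  With the onset law `(1,2,2)² ⊆ H`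
for `|H| ≥ 12` it puts `(1,2,2)¹⁶` into `ℤ/13 × ℤ/5 × ℤ/5` and `ℤ/16 × ℤ/5 × ℤ/5` by the product route (`8 · 2 = 16`) — two seed types of the k = 16 plan that
no other search-free route reached.

References: Blasiak–Church–Cohn–Grochow–Naslund–Sawin–Umans, Discrete Analysis 2017:3, Def. 3.1 (tree `IsTricoloredSumFree`).
-/

open Literature.Computability.AlgebraicComplexity Literature.Combinatorics.Additive

namespace Summit.MatrixMultiplication.OmegaCensus

/-- `ℤ/5 × ℤ/5` carries a tricolored sum-free set of size 8. -/
theorem exists_isTSF_eight_zmod5_sq : ∃ s t u : Fin 8 → ZMod 5 × ZMod 5, IsTricoloredSumFree s t u :=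
  ⟨![(0,0), (0,1), (0,3), (1,1), (3,0), (4,1), (4,3), (4,4)],
    ![(0,0), (0,1), (1,0), (0,3), (4,2), (4,3), (3,2), (3,0)],
    ![(0,0), (0,3), (4,2), (4,1), (3,3), (2,1), (3,0), (3,1)], by unfold IsTricoloredSumFree; decide⟩

end Summit.MatrixMultiplication.OmegaCensus
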